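import Summits.RiemannHypothesis.RiemannHypothesis.Theorems.TiltedLandingLaw421R3MenuThinTop

/-!
# W-09 · C4 «kernel desk» (rh-idea-6 g46) — «MenuThinLeaf»: the K-free 3-menu REDUCED LEAF of the `R = 2` menu law, and its uniform form

SUPPORT toward crux ⟨stmt-RiemannHypothesis-27010⟩ `…EarlyAppointments.TiltedLandingLaw421RT`.  LEAF module over the DOORS module «MenuThinTop»
((CA1200)(4)): §1 `ReducedLeaf3Sig` — for every legal normal-form datum of #1311's `MenuThinCertFormSig`, PER-DATUM constants `(j, d)` with the two
A-families `JBoundOn j`, `DlBoundOn d` on ∂ and door 1 (`0 ≤ A_{27/256,j,d}`) or door 2 (`0 < A_{1,j,d} ∧ 0 ≤ H_{j,d}`), or `g` with `GBoundOn g`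
and door 4 (`0 ≤ T_g`), at the chart point `Q = δ²/(Y²−t²)`, `r = (Y+t)/(Y−t)`; ★★ `menuThinCertFormSig_of_reduced3 : ReducedLeaf3Sig →
MenuThinCertFormSig lam (27/256)` for EVERY `lam`, hence `CertificatesExistThinSig (√5/2)` via #1315 by name.  §2 the UNIFORM form = the E5 work
list: `Dl ≤ 1` is free (`dlBoundOn_one`); `UniformBoxesSig j g` (two box lemmas: `J ≤ j`, `G ≥ g` for every legal datum — C3 g59's atlas:
`sup J ≈ 1.51`, `inf` of the mediant bound `≈ .419`) and the flat 2-variable trichotomy `FlatDoors3Sig j d g` over `Q ∈ [0,1)`, `r > 1`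
(C3 g59 cert2var packages PH `(9/2, 1, 9/25)` / PA `(3, 1, 1/5)`; C1 g42 «LimitMenuRooms» `MenuFlat3Sig`) give `ReducedLeaf3Sig`
(★ `reducedLeaf3_of_uniform`).  Every `…Sig` here is an OPEN hypothesis, asserted by nothing; C3 g59 RESULT-2's legal witness
`(s,h,δ,t,Y) = (0.297, 0.6, 0.139456, 0.18375, 0.25725)`, which refutes every 2-menu law, is carried by door 2 (float room `64A₁²/(Nk·rE) ≈ 10.7`).
Nothing in this file bears on the truth of RH; the leaf, these `Sig`s and ⟨27010⟩ stay OPEN.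
-/

noncomputable section

namespace RhW08.MenuThinLeaf

open RhW08.SinkBdry RhW08.SinkConePos RhW08.MenuThin RhW08.MenuThinNF RhW08.MenuThinQR RhW08.LimitMenu RhW08.MenuThinTop

/-! ## §1 The per-datum reduced leaf and the assembly by name -/

/-- THE K-FREE 3-MENU REDUCED LEAF (OPEN as typed, asserted by nothing): for every legal NF datum (chart point `Q = δ²/(Y²−t²)`, `r = (Y+t)/(Y−t)`)
PER-DATUM constants: `(j,d)` with the A-families on ∂ and `0 ≤ A_{27/256,j,d}`, OR with `0 < A_{1,j,d} ∧ 0 ≤ H_{j,d}`, OR `g` with the G-family, `0 ≤ T_g`. -/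
def ReducedLeaf3Sig : Prop :=
  ∀ (s h δ t Y : ℝ),
    0 < s → 2 * s ≤ h → 3 * h < 2 → 0 < Y → Y ≤ h → 0 < t → t < Y → Y - s / 4 < t → δ ^ 2 + t ^ 2 < Y ^ 2 → 0 ≤ δ →
    (∃ j d : ℝ, JBoundOn j h δ t ∧ DlBoundOn d h δ t ∧ 0 ≤ limAjd (27 / 256) j d (δ ^ 2 / (Y ^ 2 - t ^ 2)) ((Y + t) / (Y - t))) ∨
    (∃ j d : ℝ, JBoundOn j h δ t ∧ DlBoundOn d h δ t ∧ 0 < limAjd 1 j d (δ ^ 2 / (Y ^ 2 - t ^ 2)) ((Y + t) / (Y - t)) ∧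
      0 ≤ limHroom j d (δ ^ 2 / (Y ^ 2 - t ^ 2)) ((Y + t) / (Y - t))) ∨
    (∃ g : ℝ, GBoundOn g h δ t ∧ 0 ≤ limTg g (δ ^ 2 / (Y ^ 2 - t ^ 2)) ((Y + t) / (Y - t)))

/-- ★★ ASSEMBLY SHAPE: the reduced leaf gives #1311's certificate form at `κ = 27/256` for EVERY `lam` (disjuncts 1, 2, 4; `lam = √5/2` feeds #1315). -/
theorem menuThinCertFormSig_of_reduced3 (lam : ℝ) (hR : ReducedLeaf3Sig) : MenuThinCertFormSig lam (27 / 256) := by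
  intro s h δ t Y hs hsh h3 hY hYh ht htY hdrop hnest hδ
  rcases hR s h δ t Y hs hsh h3 hY hYh ht htY hdrop hnest hδ with ⟨j, d, hJ, hD, hA⟩ | ⟨j, d, hJ, hD, hA, hH⟩ | ⟨g, hG, hT⟩
  · exact Or.inl (asec_of_JDl h3 hYh ht htY hnest hδ hJ hD hA)
  · exact Or.inr (Or.inl (ahp_of_JDl hs h3 hYh ht htY hdrop hnest hδ hJ hD hA hH))
  · exact Or.inr (Or.inr (Or.inr (tihp_of_GBound_limTg hs hsh h3 hYh ht htY hdrop hnest hδ hG hT)))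

/-- by name: the reduced leaf closes the sink certificates of #1303 (through #1315 `certificatesExistThinSig_of_kitCertForm`). -/
theorem certificatesExistThinSig_of_reduced3 (hR : ReducedLeaf3Sig) : RhW08.SinkThin.CertificatesExistThinSig (Real.sqrt 5 / 2) :=
  RhW08.MenuThinEdge.certificatesExistThinSig_of_kitCertForm (menuThinCertFormSig_of_reduced3 _ hR)

/-! ## §2 The uniform form: two box lemmas and one flat trichotomy -/

/-- a pointwise fact on the thin boundary (`|ξ| ≥ 1`, `0 ≤ b ≤ 1 − h`, `h ≤ 1`) IS a boundary family. -/
theorem onThinBdry_of_forall {h : ℝ} {P : ℝ → ℝ → Prop} (hh : h ≤ 1) (hP : ∀ ξ b, 1 ≤ |ξ| → 0 ≤ b → b ≤ 1 - h → P ξ b) : OnThinBdry h P :=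
  ⟨fun b hb hb' => hP 1 b (by simp) hb hb', fun b hb hb' => hP (-1) b (by simp) hb hb',
    fun ξ hξ => hP ξ _ (hξ.trans (le_abs_self ξ)) (by linarith) le_rfl, fun ξ hξ => hP ξ _ (hξ.trans (neg_le_abs ξ)) (by linarith) le_rfl⟩

/-- `Dl ≤ 1` IS FREE: `c_w − c_{p₀} ≤ c_w` on ∂ because `c_{p₀}(u) ≥ 0` there (no pole of `p₀ = it` on the thin boundary, `0 < h ≤ 1`, `t > 0`). -/
theorem dlBoundOn_one {h δ t : ℝ} (hh0 : 0 < h) (hh1 : h ≤ 1) (ht : 0 < t) : DlBoundOn 1 h δ t :=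
  onThinBdry_of_forall hh1 fun ξ b hξ hb0 hb => by
    have hc : 0 < pairCForm 0 t ξ b := pairCForm_pos ht (by nlinarith [sq_lt_bdry le_rfl hh0 hξ hb0 hb, sq_nonneg t])
    show pairCForm δ t ξ b - pairCForm 0 t ξ b ≤ 1 * pairCForm δ t ξ b
    linarith

/-- UNIFORM BOXES (OPEN, the two E5 box lemmas): constants `j`, `g` with `J ≤ j` and `G ≥ g` (product form) on ∂ for EVERY legal NF datum. -/
def UniformBoxesSig (j g : ℝ) : Prop :=
  ∀ (s h δ t Y : ℝ),
    0 < s → 2 * s ≤ h → 3 * h < 2 → 0 < Y → Y ≤ h → 0 < t → t < Y → Y - s / 4 < t → δ ^ 2 + t ^ 2 < Y ^ 2 → 0 ≤ δ →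
    JBoundOn j h δ t ∧ GBoundOn g h δ t

/-- THE FLAT TRICHOTOMY (OPEN; a 2-variable semialgebraic statement, C3 g59-certified for `(9/2, 1, 9/25)` and `(3, 1, 1/5)`): at every chart point
`Q ∈ [0,1)`, `r > 1` one of door 1 `0 ≤ A_{27/256,j,d}`, door 2 `0 < A_{1,j,d} ∧ 0 ≤ H_{j,d}`, door 4 `0 ≤ T_g` is open. -/
def FlatDoors3Sig (j d g : ℝ) : Prop :=
  ∀ (Q r : ℝ), 0 ≤ Q → Q < 1 → 1 < r →
    0 ≤ limAjd (27 / 256) j d Q r ∨ (0 < limAjd 1 j d Q r ∧ 0 ≤ limHroom j d Q r) ∨ 0 ≤ limTg g Q r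

/-- ★ UNIFORM ⇒ PER-DATUM: box constants `(j, d, g)` valid for every legal datum and the flat trichotomy at `(j, d, g)` give the reduced leaf. -/
theorem reducedLeaf3_of_uniform3 {j d g : ℝ}
    (hB : ∀ (s h δ t Y : ℝ), 0 < s → 2 * s ≤ h → 3 * h < 2 → 0 < Y → Y ≤ h → 0 < t → t < Y → Y - s / 4 < t → δ ^ 2 + t ^ 2 < Y ^ 2 →
      0 ≤ δ → JBoundOn j h δ t ∧ DlBoundOn d h δ t ∧ GBoundOn g h δ t)
    (hF : FlatDoors3Sig j d g) : ReducedLeaf3Sig := by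
  intro s h δ t Y hs hsh h3 hY hYh ht htY hdrop hnest hδ
  obtain ⟨hJ, hD, hG⟩ := hB s h δ t Y hs hsh h3 hY hYh ht htY hdrop hnest hδ
  obtain ⟨-, hr, hQ0, hQ1, -⟩ := chart_of_datum ht htY hnest
  rcases hF _ _ hQ0 hQ1 hr with h1 | h2 | h4
  · exact Or.inl ⟨j, d, hJ, hD, h1⟩
  · exact Or.inr (Or.inl ⟨j, d, hJ, hD, h2.1, h2.2⟩)
  · exact Or.inr (Or.inr ⟨g, hG, h4⟩)

/-- ★ THE E5 WORK LIST: `UniformBoxesSig j g` (two box lemmas) and `FlatDoors3Sig j 1 g` (one flat trichotomy, `Dl ≤ 1` free) give the reduced leaf. -/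
theorem reducedLeaf3_of_uniform {j g : ℝ} (hU : UniformBoxesSig j g) (hF : FlatDoors3Sig j 1 g) : ReducedLeaf3Sig :=
  reducedLeaf3_of_uniform3 (fun s h δ t Y hs hsh h3 hY hYh ht htY hdrop hnest hδ =>
    have hJG := hU s h δ t Y hs hsh h3 hY hYh ht htY hdrop hnest hδ
    ⟨hJG.1, dlBoundOn_one (by linarith) (by linarith) ht, hJG.2⟩) hF

/-- by name: the E5 work list closes the sink certificates (through `certificatesExistThinSig_of_reduced3`). -/
theorem certificatesExistThinSig_of_uniform {j g : ℝ} (hU : UniformBoxesSig j g) (hF : FlatDoors3Sig j 1 g) :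
    RhW08.SinkThin.CertificatesExistThinSig (Real.sqrt 5 / 2) :=
  certificatesExistThinSig_of_reduced3 (reducedLeaf3_of_uniform hU hF)

end RhW08.MenuThinLeaf

end
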